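import Summits.Parity.BatemanHorn.Theorems.AlmostPrimeZerosLinearCappedRepulsionRieszDiffKeyhole
import HarnessLib

/-!
# One-sided Selberg–Delange for a difference of Riesz means, II: fixed admissible parameters
(crux stmt-Parity-11327, line `jensen-stieltjes-majorant`, stub `stub_rieszDiffEngine`)

Everything here is PROVED (theorems only).  Part of the one-sided Selberg–Delange bound for the
DIFFERENCE of two Riesz means `A₁(x+h) − A₁(x)` of a Dirichlet series `Σ a(n) n^{-s} = ζ(s)^z G(s)`
(data `SelbergDelange.RieszData R (4/5) B z a G` of the tree's contour engine
`Literature/NumberTheory/LFunctions/SelbergDelangeRieszExpansion.lean`, Montgomery–Vaughan §7.4,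
proof of Theorem 7.17): `‖A₁(x+h) − A₁(x)‖ ≤ h·x·(log x)^{Re z−1}·B·e^{c(1+R)^{3/2}}` for
`x e^{−(log log x)³} ≤ h ≤ x`, `1 ≤ R ≤ log log x` — the SIZE of the main term with every constant
explicit in `R`, no main term, no Hankel evaluation, no Taylor expansion at the branch point.

This file: Perron's formula for the two Riesz means on `Re s = 1 + 1/log x`, Cauchy's theorem to the
keyhole contour for each, the tails / horizontal sides / left sides of EACH bounded by the tree
lemmas, the two keyholes bounded as a difference (`RieszDiff.norm_keyhole_diff_le`).

## References

* [MontgomeryVaughan2007] H. L. Montgomery, R. C. Vaughan, *Multiplicative Number Theory I*,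
  CUP 2007, §7.4, proof of Theorem 7.17 (pp. 177–178).
* [Tenenbaum2015] G. Tenenbaum, *Introduction to analytic and probabilistic number theory*, 3rd
  ed., AMS GSM 163, II.5 §§5.3–5.4.
-/

noncomputable section

open Complex Set MeasureTheory Filter Topology intervalIntegral Metric
open scoped Real Nat Interval
open Literature.Analysis.Complex Literature.Analysis.Complex.Keyhole
open Literature.NumberTheory.LFunctions Literature.NumberTheory.LFunctions.SelbergDelange

namespace Summit.Parity.BatemanHorn.Cruxes.LinearCappedRepulsion.JensenStieltjesMajorant

namespace RieszDiff

/-! ### The estimate for the difference at fixed admissible parameters -/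

/-- **The one-sided Selberg–Delange estimate for `A₁(y) − A₁(x)` at fixed admissible parameters**
(`1 < x ≤ y ≤ 2x`, `L = log x ≥ 1`, `T ≥ 1`, `σ₁ < b = b(T)`, `β = L(1 − b) ≥ 1`, `(β + 1)/L ≤ ρ/4`):
Perron's formula for the two Riesz means on `Re s = 1 + 1/L`, Cauchy's theorem to the keyhole contour
(`SelbergDelange.line_integral_eq_keyhole`) for each, the tails / horizontal sides / left sides of
EACH bounded by the tree lemmas (with `t^{1+a} ≤ (2x)^{1+a}`, `t^{1+b} ≤ (2x)^{1+b}` for `t = x, y`),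
and the two keyholes bounded as a DIFFERENCE (`norm_keyhole_diff_le`).
[cite: MontgomeryVaughan2007, §7.4 pp. 177–178] -/
theorem norm_rieszMean_diff_le_of_params {R σ₁ B : ℝ} {z : ℂ} {a : ℕ → ℂ} {G : ℂ → ℂ}
    (h : RieszData R σ₁ B z a G) (hσ₁1 : σ₁ < 1) {Cf Cn : ℝ}
    (hCf : ∀ z s : ℂ, ‖z‖ ≤ R → s ∈ zfrRegion → 1 ≤ |s.im| →
      ‖zetaPow z s‖ ≤ Cf * Real.log (|s.im| + 3) ^ R)
    (hCn : ∀ z s : ℂ, ‖z‖ ≤ R → |s.im| ≤ 1 → 1 - zfrWidth 1 / 2 ≤ s.re → s.re ≤ 2 →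
      ‖exp (z * logZeta₁ s)‖ ≤ Cn)
    {x y : ℝ} (hx : 1 < x) (hxy : x ≤ y) (hy2 : y ≤ 2 * x) (hL : 1 ≤ Real.log x) {T : ℝ}
    (hT : 1 ≤ T) (hσ₁b : σ₁ < leftAbscissa T) (hβ : 1 ≤ Real.log x * (1 - leftAbscissa T))
    (hfit : (Real.log x * (1 - leftAbscissa T) + 1) / Real.log x ≤ rho σ₁ / 4) :
    ‖(∑ n ∈ Finset.Ioc 0 ⌊y⌋₊, a n * ((y : ℂ) - n)) -
        ∑ n ∈ Finset.Ioc 0 ⌊x⌋₊, a n * ((x : ℂ) - n)‖ ≤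
      (2 * π)⁻¹ * (
        4 * ((2 * x) ^ (1 + (1 + 1 / Real.log x)) * (B / (1 / Real.log x) ^ R) / T) +
        4 * ((1 + 1 / Real.log x - leftAbscissa T) * ((2 * x) ^ (1 + (1 + 1 / Real.log x)) *
          (Cf * Real.log (T + 3) ^ R) * B / T ^ 2)) +
        4 * (4 * π * ((2 * x) ^ (1 + leftAbscissa T) * (Cf * Real.log (T + 3) ^ R) * B)) +
        4 * (4 * ((2 * x) ^ (1 + leftAbscissa T) * Cn * Real.exp (π * R) * B *
          ((1 - leftAbscissa T) ^ (-R) + 2 ^ R))) +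
        13 * Real.exp (π * R) * (Cn * B * 2) * keyholeConst ⌈R⌉₊ * (y - x) * x *
          Real.log x ^ (z.re - 1)) := by
  -- parameters
  set L : ℝ := Real.log x with hLdef
  have hL0 : 0 < L := by linarith
  have hx0 : 0 < x := by linarith
  have hx1 : 1 ≤ x := hx.le
  set aa : ℝ := 1 + 1 / L with haa
  have haa1 : 1 < aa := by rw [haa]; linarith [show (0:ℝ) < 1 / L by positivity]
  have haa2 : aa ≤ 2 := by
    have : 1 / L ≤ 1 := by rw [div_le_one hL0]; exact hL
    rw [haa]; linarith
  set δ : ℝ := 1 / L with hδ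
  have hδ0 : 0 < δ := by positivity
  have hδ1 : δ ≤ 1 := by rw [hδ, div_le_one hL0]; exact hL
  set b : ℝ := leftAbscissa T with hbdef
  set β : ℝ := L * (1 - b) with hβdef
  have hb1 : b < 1 := leftAbscissa_lt_one (by linarith)
  have hbhalf : 1 / 2 < b := (leftAbscissa_ge hT).2
  have hbβ : b = 1 - β / L := by rw [hβdef]; field_simp; ring
  have hba : b ≤ aa := by linarith
  have hR : 0 ≤ R := (norm_nonneg _).trans h.norm_le
  have hB0 : 0 ≤ B := (norm_nonneg _).trans (h.norm_G_le 2 (by simp; linarith))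
  have hCn0 : 0 ≤ Cn := (norm_nonneg _).trans (hCn z 2 h.norm_le (by simp)
    (by simp; linarith [zfrWidth_pos 1]) (by simp))
  have hCf0 : 0 ≤ Cf * Real.log (T + 3) ^ R := by
    have hmem : ((2 : ℂ) + T * I) ∈ zfrRegion :=
      mem_zfrRegion_of_leftAbscissa_le hT (by simp; linarith)
        (by simp [abs_of_pos (by linarith : (0:ℝ) < T)])
    have := hCf z _ h.norm_le hmem (by simp [abs_of_pos (by linarith : (0:ℝ) < T)]; exact hT)
    have him : ((2 : ℂ) + T * I).im = T := by simp
    rw [him, abs_of_pos (by linarith : (0:ℝ) < T)] at this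
    exact (norm_nonneg _).trans this
  -- the majorant series on the line
  have hS : ∑' n : ℕ, ‖LSeries.term a (aa : ℂ) n‖ ≤ B / (1 / L) ^ R := by
    have := h.majorant aa haa1 haa2
    rwa [show aa - 1 = 1 / L by rw [haa]; ring] at this
  have hS0 : 0 ≤ ∑' n : ℕ, ‖LSeries.term a (aa : ℂ) n‖ := tsum_nonneg fun _ ↦ norm_nonneg _
  -- the pieces of the contour, for a general `t ∈ [x, 2x]`
  have hpieces : ∀ t : ℝ, x ≤ t → t ≤ 2 * x →
      let Tails : ℂ := (∫ τ in Iic (-T), integrand z G t (aa + τ * I)) +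
        ∫ τ in Ioi T, integrand z G t (aa + τ * I)
      let Hor : ℂ := (∫ u in b..aa, integrand z G t (u + T * I)) -
        ∫ u in b..aa, integrand z G t (u + (-T) * I)
      let Left : ℂ := (∫ τ in (-T)..(-δ), integrand z G t (b + τ * I)) +
        ∫ τ in δ..T, integrand z G t (b + τ * I)
      I * ∫ τ : ℝ, integrand z G t (aa + τ * I) =
          I * Tails + keyhole (integrand z G t) b aa δ + Hor + I * Left ∧
        ‖Tails‖ ≤ 2 * ((2 * x) ^ (1 + aa) * (B / (1 / L) ^ R) / T) ∧
        ‖Hor‖ ≤ 2 * ((aa - b) * ((2 * x) ^ (1 + aa) * (Cf * Real.log (T + 3) ^ R) * B / T ^ 2)) ∧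
        ‖Left‖ ≤ 2 * (4 * π * ((2 * x) ^ (1 + b) * (Cf * Real.log (T + 3) ^ R) * B)) +
          2 * (4 * ((2 * x) ^ (1 + b) * Cn * Real.exp (π * R) * B * ((1 - b) ^ (-R) + 2 ^ R))) := by
    intro t hxt ht2 Tails Hor Left
    have ht0 : 0 < t := by linarith
    have ht1 : 1 ≤ t := by linarith
    have htaa : t ^ (1 + aa) ≤ (2 * x) ^ (1 + aa) := Real.rpow_le_rpow ht0.le ht2 (by linarith)
    have htb : t ^ (1 + b) ≤ (2 * x) ^ (1 + b) := Real.rpow_le_rpow ht0.le ht2 (by linarith)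
    -- decomposition
    have hint := integrable_integrand_line h ht0 haa1
    have hdec := line_integral_eq_keyhole (Φ := integrand z G t) hba (by linarith : δ ≤ T) hint
      (differentiableOn_integrand_rect h ht0 hT hδ0 hσ₁b (Or.inl ⟨le_rfl, le_rfl⟩))
      (differentiableOn_integrand_rect h ht0 hT hδ0 hσ₁b (Or.inr ⟨le_rfl, le_rfl⟩))
    refine ⟨hdec, ?_, ?_, ?_⟩
    · -- tails
      obtain ⟨htail1, htail2⟩ := norm_integral_tails_le h ht0 haa1 (by linarith : 0 < T)
      have htailB : t ^ (1 + aa) * (∑' n : ℕ, ‖LSeries.term a (aa : ℂ) n‖) / T ≤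
          (2 * x) ^ (1 + aa) * (B / (1 / L) ^ R) / T :=
        div_le_div_of_nonneg_right (mul_le_mul htaa hS hS0 (by positivity)) (by linarith)
      calc ‖Tails‖ ≤ ‖∫ τ in Iic (-T), integrand z G t (aa + τ * I)‖ +
            ‖∫ τ in Ioi T, integrand z G t (aa + τ * I)‖ := norm_add_le _ _
        _ ≤ _ := by linarith [htail1.trans htailB, htail2.trans htailB]
    · -- horizontal sides
      have hhor1 := norm_integral_horizontal_le h ht1 hT hσ₁b hba hCf (T' := T)
        (abs_of_pos (by linarith))
      have hhor2 := norm_integral_horizontal_le h ht1 hT hσ₁b hba hCf (T' := -T)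
        (by rw [abs_neg, abs_of_pos (by linarith)])
      have hmono : (aa - b) * (t ^ (1 + aa) * (Cf * Real.log (T + 3) ^ R) * B / T ^ 2) ≤
          (aa - b) * ((2 * x) ^ (1 + aa) * (Cf * Real.log (T + 3) ^ R) * B / T ^ 2) := by
        refine mul_le_mul_of_nonneg_left ?_ (by linarith)
        exact div_le_div_of_nonneg_right (mul_le_mul_of_nonneg_right
          (mul_le_mul_of_nonneg_right htaa hCf0) hB0) (by positivity)
      calc ‖Hor‖ ≤ ‖∫ u in b..aa, integrand z G t (u + T * I)‖ +
            ‖∫ u in b..aa, integrand z G t (u + (-T) * I)‖ := norm_sub_le _ _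
        _ ≤ _ := by push_cast at hhor2 ⊢; linarith [hhor1, hhor2]
    · -- left sides
      have hii := fun (p q : ℝ) (hpq : p ≤ q) (h0 : 0 < p ∨ q < 0) (hp : -(T + 1) ≤ p)
        (hq : q ≤ T + 1) ↦ intervalIntegrable_left h ht0 hT hσ₁b hpq h0 hp hq
      have hsplit1 : ∫ τ in δ..T, integrand z G t (b + τ * I) =
          (∫ τ in δ..(1:ℝ), integrand z G t (b + τ * I)) +
            ∫ τ in (1:ℝ)..T, integrand z G t (b + τ * I) :=
        (intervalIntegral.integral_add_adjacent_intervals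
          (hii δ 1 hδ1 (Or.inl hδ0) (by linarith) (by linarith))
          (hii 1 T hT (Or.inl one_pos) (by linarith) (by linarith))).symm
      have hsplit2 : ∫ τ in (-T)..(-δ), integrand z G t (b + τ * I) =
          (∫ τ in (-T)..(-1:ℝ), integrand z G t (b + τ * I)) +
            ∫ τ in (-1:ℝ)..(-δ), integrand z G t (b + τ * I) :=
        (intervalIntegral.integral_add_adjacent_intervals
          (hii (-T) (-1) (by linarith) (Or.inr (by norm_num)) (by linarith) (by linarith))
          (hii (-1) (-δ) (by linarith) (Or.inr (by linarith)) (by linarith) (by linarith))).symm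
      have hfar1 := norm_integral_left_far_le h hR ht1 hT hσ₁b hCf hT (Or.inl ⟨le_rfl, le_rfl⟩)
      have hfar2 := norm_integral_left_far_le h hR ht1 hT hσ₁b hCf (show -T ≤ -1 by linarith)
        (Or.inr ⟨le_rfl, le_rfl⟩)
      have hnear1 := norm_integral_left_near_le h ht1 hT hσ₁b hCn hδ0 hδ1 (Or.inl ⟨le_rfl, le_rfl⟩)
      have hnear2 := norm_integral_left_near_le h ht1 hT hσ₁b hCn hδ0 (show -1 ≤ -δ by linarith)
        (Or.inr ⟨le_rfl, le_rfl⟩)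
      have hmonofar : 4 * π * (t ^ (1 + b) * (Cf * Real.log (T + 3) ^ R) * B) ≤
          4 * π * ((2 * x) ^ (1 + b) * (Cf * Real.log (T + 3) ^ R) * B) := by
        refine mul_le_mul_of_nonneg_left ?_ (by positivity)
        exact mul_le_mul_of_nonneg_right (mul_le_mul_of_nonneg_right htb hCf0) hB0
      have h1b : 0 ≤ (1 - b) ^ (-R) + 2 ^ R := by
        have : 0 < 1 - b := by linarith
        positivity
      have hmononear : 4 * (t ^ (1 + b) * Cn * Real.exp (π * R) * B * ((1 - b) ^ (-R) + 2 ^ R)) ≤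
          4 * ((2 * x) ^ (1 + b) * Cn * Real.exp (π * R) * B * ((1 - b) ^ (-R) + 2 ^ R)) := by
        refine mul_le_mul_of_nonneg_left ?_ (by norm_num)
        refine mul_le_mul_of_nonneg_right ?_ h1b
        refine mul_le_mul_of_nonneg_right ?_ hB0
        refine mul_le_mul_of_nonneg_right ?_ (Real.exp_pos _).le
        exact mul_le_mul_of_nonneg_right htb hCn0
      have e : Left = (∫ τ in (-T)..(-1:ℝ), integrand z G t (b + τ * I)) +
          (∫ τ in (-1:ℝ)..(-δ), integrand z G t (b + τ * I)) +
          ((∫ τ in δ..(1:ℝ), integrand z G t (b + τ * I)) +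
            ∫ τ in (1:ℝ)..T, integrand z G t (b + τ * I)) := by
        show (∫ τ in (-T)..(-δ), integrand z G t (b + τ * I)) +
          ∫ τ in δ..T, integrand z G t (b + τ * I) = _
        rw [hsplit1, hsplit2]
      rw [e]
      calc ‖(∫ τ in (-T)..(-1:ℝ), integrand z G t (b + τ * I)) +
            (∫ τ in (-1:ℝ)..(-δ), integrand z G t (b + τ * I)) +
            ((∫ τ in δ..(1:ℝ), integrand z G t (b + τ * I)) +
              ∫ τ in (1:ℝ)..T, integrand z G t (b + τ * I))‖
          ≤ ‖∫ τ in (-T)..(-1:ℝ), integrand z G t (b + τ * I)‖ +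
            ‖∫ τ in (-1:ℝ)..(-δ), integrand z G t (b + τ * I)‖ +
            (‖∫ τ in δ..(1:ℝ), integrand z G t (b + τ * I)‖ +
              ‖∫ τ in (1:ℝ)..T, integrand z G t (b + τ * I)‖) :=
            norm_add_le_of_le (norm_add_le _ _) (norm_add_le _ _)
        _ ≤ _ := by linarith [hfar1.trans hmonofar, hfar2.trans hmonofar, hnear1.trans hmononear,
            hnear2.trans hmononear]
  -- Perron's formula for the two Riesz means (same line `Re s = aa`)
  have hPerron : ∀ t : ℝ, 0 < t → ∑ n ∈ Finset.Ioc 0 ⌊t⌋₊, a n * ((t : ℂ) - n) =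
      (1 / (2 * π) : ℂ) * ∫ τ : ℝ, integrand z G t (aa + τ * I) := by
    intro t ht
    rw [RieszMean.sum_mul_sub_eq_integral_LSeries a ht (by linarith : 0 < aa) (h.summable aa haa1)]
    congr 1
    exact integral_congr_ae (Eventually.of_forall fun τ ↦ (integrand_line_eq h t haa1 τ).symm)
  have hy0 : 0 < y := by linarith
  set Jx : ℂ := ∫ τ : ℝ, integrand z G x (aa + τ * I) with hJx
  set Jy : ℂ := ∫ τ : ℝ, integrand z G y (aa + τ * I) with hJy
  obtain ⟨hdecx, hTx, hHx, hLx⟩ := hpieces x le_rfl (by linarith)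
  obtain ⟨hdecy, hTy, hHy, hLy⟩ := hpieces y hxy hy2
  -- names for the pieces
  set TailsX : ℂ := (∫ τ in Iic (-T), integrand z G x (aa + τ * I)) +
    ∫ τ in Ioi T, integrand z G x (aa + τ * I) with hTailsX
  set TailsY : ℂ := (∫ τ in Iic (-T), integrand z G y (aa + τ * I)) +
    ∫ τ in Ioi T, integrand z G y (aa + τ * I) with hTailsY
  set HorX : ℂ := (∫ u in b..aa, integrand z G x (u + T * I)) -
    ∫ u in b..aa, integrand z G x (u + (-T) * I) with hHorX
  set HorY : ℂ := (∫ u in b..aa, integrand z G y (u + T * I)) -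
    ∫ u in b..aa, integrand z G y (u + (-T) * I) with hHorY
  set LeftX : ℂ := (∫ τ in (-T)..(-δ), integrand z G x (b + τ * I)) +
    ∫ τ in δ..T, integrand z G x (b + τ * I) with hLeftX
  set LeftY : ℂ := (∫ τ in (-T)..(-δ), integrand z G y (b + τ * I)) +
    ∫ τ in δ..T, integrand z G y (b + τ * I) with hLeftY
  set KHX : ℂ := keyhole (integrand z G x) b aa δ with hKHX
  set KHY : ℂ := keyhole (integrand z G y) b aa δ with hKHY
  -- the keyhole difference
  have hKH : ‖KHY - KHX‖ ≤ 13 * Real.exp (π * R) * (Cn * B * 2) * keyholeConst ⌈R⌉₊ * (y - x) * x *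
      L ^ (z.re - 1) := by
    have hfit' : (β + 1) / Real.log x ≤ rho σ₁ / 4 := hfit
    have := norm_keyhole_diff_le h hσ₁1 hCn hx hxy hy2 hβ hfit'
    rw [← hLdef, ← hbβ] at this
    simpa only [hKHY, hKHX, haa, hδ] using this
  -- assemble
  have key : 2 * π * I * ((∑ n ∈ Finset.Ioc 0 ⌊y⌋₊, a n * ((y : ℂ) - n)) -
      ∑ n ∈ Finset.Ioc 0 ⌊x⌋₊, a n * ((x : ℂ) - n)) =
      I * (TailsY - TailsX) + (KHY - KHX) + (HorY - HorX) + I * (LeftY - LeftX) := by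
    have hπ : (π : ℂ) ≠ 0 := ofReal_ne_zero.2 Real.pi_pos.ne'
    have e1 : ∀ J : ℂ, 2 * π * I * ((1 / (2 * π) : ℂ) * J) = I * J := fun J ↦ by field_simp
    rw [hPerron y hy0, hPerron x hx0, ← hJy, ← hJx, mul_sub, e1, e1]
    have hdecx' : I * Jx = I * TailsX + KHX + HorX + I * LeftX := hdecx
    have hdecy' : I * Jy = I * TailsY + KHY + HorY + I * LeftY := hdecy
    rw [hdecx', hdecy']
    ring
  have hnorm : ‖(∑ n ∈ Finset.Ioc 0 ⌊y⌋₊, a n * ((y : ℂ) - n)) -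
      ∑ n ∈ Finset.Ioc 0 ⌊x⌋₊, a n * ((x : ℂ) - n)‖ =
      (2 * π)⁻¹ * ‖I * (TailsY - TailsX) + (KHY - KHX) + (HorY - HorX) + I * (LeftY - LeftX)‖ := by
    rw [← key, norm_mul, norm_mul, norm_mul, Complex.norm_I, Complex.norm_real,
      Real.norm_of_nonneg Real.pi_pos.le, Complex.norm_two]
    field_simp
  rw [hnorm]
  refine mul_le_mul_of_nonneg_left ?_ (by positivity)
  have htri : ‖I * (TailsY - TailsX) + (KHY - KHX) + (HorY - HorX) + I * (LeftY - LeftX)‖ ≤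
      (‖TailsY‖ + ‖TailsX‖) + ‖KHY - KHX‖ + (‖HorY‖ + ‖HorX‖) + (‖LeftY‖ + ‖LeftX‖) := by
    have e1 : ‖I * (TailsY - TailsX)‖ = ‖TailsY - TailsX‖ := by
      rw [norm_mul, Complex.norm_I, one_mul]
    have e2 : ‖I * (LeftY - LeftX)‖ = ‖LeftY - LeftX‖ := by
      rw [norm_mul, Complex.norm_I, one_mul]
    calc _ ≤ ‖I * (TailsY - TailsX) + (KHY - KHX) + (HorY - HorX)‖ + ‖I * (LeftY - LeftX)‖ :=
          norm_add_le _ _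
      _ ≤ ‖I * (TailsY - TailsX) + (KHY - KHX)‖ + ‖HorY - HorX‖ + ‖I * (LeftY - LeftX)‖ := by
          gcongr; exact norm_add_le _ _
      _ ≤ ‖I * (TailsY - TailsX)‖ + ‖KHY - KHX‖ + ‖HorY - HorX‖ + ‖I * (LeftY - LeftX)‖ := by
          gcongr; exact norm_add_le _ _
      _ = ‖TailsY - TailsX‖ + ‖KHY - KHX‖ + ‖HorY - HorX‖ + ‖LeftY - LeftX‖ := by rw [e1, e2]
      _ ≤ _ := by
          gcongr
          · exact norm_sub_le _ _
          · exact norm_sub_le _ _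
          · exact norm_sub_le _ _
  refine htri.trans ?_
  have haab : aa - b = 1 + 1 / L - b := by rw [haa]
  rw [haab] at hHx hHy
  linarith [hTx, hTy, hHx, hHy, hLx, hLy, hKH]

end RieszDiff

/-- **Registered sub-goal `stub_rieszDiffParams` of crux stmt-Parity-11327** (part of `stub_rieszDiffEngine`):
the fixed-parameter estimate (`RieszDiff.norm_rieszMean_diff_le_of_params`, ∀-closed). [cite: MontgomeryVaughan2007, §7.4 pp. 177–178] -/
theorem stub_rieszDiffParams :
      ∀ (R σ₁ B : ℝ) (z : ℂ) (a : ℕ → ℂ) (G : ℂ → ℂ), SelbergDelange.RieszData R σ₁ B z a G → σ₁ < 1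
      → ∀ Cf Cn : ℝ, (∀ w s : ℂ, ‖w‖ ≤ R → s ∈ zfrRegion → 1 ≤ |s.im| → ‖SelbergDelange.zetaPow w s‖
      ≤ Cf * Real.log (|s.im| + 3) ^ R) → (∀ w s : ℂ, ‖w‖ ≤ R → |s.im| ≤ 1 → 1 - zfrWidth 1 / 2 ≤
      s.re → s.re ≤ 2 → ‖Complex.exp (w * logZeta₁ s)‖ ≤ Cn) → ∀ x y : ℝ, 1 < x → x ≤ y → y ≤ 2 * x
      → 1 ≤ Real.log x → ∀ T : ℝ, 1 ≤ T → σ₁ < SelbergDelange.leftAbscissa T → 1 ≤ Real.log x * (1 -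
      SelbergDelange.leftAbscissa T) → (Real.log x * (1 - SelbergDelange.leftAbscissa T) + 1) /
      Real.log x ≤ SelbergDelange.rho σ₁ / 4 → ‖(∑ n ∈ Finset.Ioc 0 ⌊y⌋₊, a n * ((y : ℂ) - n)) - ∑ n
      ∈ Finset.Ioc 0 ⌊x⌋₊, a n * ((x : ℂ) - n)‖ ≤ (2 * Real.pi)⁻¹ * (4 * ((2 * x) ^ (1 + (1 + 1 /
      Real.log x)) * (B / (1 / Real.log x) ^ R) / T) + 4 * ((1 + 1 / Real.log x -
      SelbergDelange.leftAbscissa T) * ((2 * x) ^ (1 + (1 + 1 / Real.log x)) * (Cf * Real.log (T +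
      3) ^ R) * B / T ^ 2)) + 4 * (4 * Real.pi * ((2 * x) ^ (1 + SelbergDelange.leftAbscissa T) *
      (Cf * Real.log (T + 3) ^ R) * B)) + 4 * (4 * ((2 * x) ^ (1 + SelbergDelange.leftAbscissa T) *
      Cn * Real.exp (Real.pi * R) * B * ((1 - SelbergDelange.leftAbscissa T) ^ (-R) + 2 ^ R))) + 13
      * Real.exp (Real.pi * R) * (Cn * B * 2) * Keyhole.keyholeConst ⌈R⌉₊ * (y - x) * x * Real.log x
      ^ (z.re - 1)) :=
  fun _ _ _ _ _ _ h hσ₁1 _ _ hCf hCn _ _ hx hxy hy2 hL _ hT hσ₁b hβ hfit =>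
    RieszDiff.norm_rieszMean_diff_le_of_params h hσ₁1 hCf hCn hx hxy hy2 hL hT hσ₁b hβ hfit

end Summit.Parity.BatemanHorn.Cruxes.LinearCappedRepulsion.JensenStieltjesMajorant
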